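import Mathlib
import Literature.NumberTheory.EllipticCurves.Smith2016.CongruentNumberGenusDeterminantBlocks
import Literature.LinearAlgebra.Matrix.AdjugateRankOne

/-!
# Reciprocity in the forest calculus: `Σ_π ∏ q_t = (Σ t)·q_t` and Smith's two-block identity for `N(A, z, y)` (row 5b)

A. Smith, *The congruent numbers have positive natural density*, arXiv:1603.08479 [Smith2016CongruentDensity],
§2.2, case 5(b) (source `cnc2.tex` l. 52–62): "we just need to prove that, if `n ≡ 5 (8)`, then
`det N(A, z, y) = Σ_{d | n, d ≡ 3 (8)} g(d) g(n/d)` … `det N(A, z, y) = Σ_{S ⊆ [r]} det O(A, z, y)[S] det O(A, y, y)[S′]`",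
where the arc weights satisfy the RECIPROCITY law `A_ij + A_ji = y_i y_j` (`i ≠ j`; [Smith2016CongruentDensity,
Prop. 2.4]: quadratic reciprocity for Monsky's additive Legendre matrix, `y = t = ((−1/pᵢ)₊)`).  In the tree's
forest language (`q_x(B) = Σ_{s∈B} x_s κ_s(B)`, `setExp` = sum over set partitions) the source's closure argument is
replaced by three identities:

* `setExp_qwt_eq_sum_mul_qwt` — **reciprocity lemma**: for `a i j + a j i = t i t j` on `S ≠ ∅`,
  `Σ_{π ∈ Part(S)} ∏_{C∈π} q_t(A^C) = (Σ_S t) · q_t(A^S)`.  Proof: the left side is `det(A^S + D_t)` (matrix-forest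
  theorem); `(A^S + D_t)ᵀ = A^S + t tᵀ` by reciprocity (`t_i² = t_i`); Cauchy's rank-one formula gives
  `det A^S + tᵀ adj(A^S) t = 0 + (Σ_S t) · det(A^S | t) = (Σ_S t) q_t(A^S)`.
* `sum_powerset_pointed_setExp_mul_setExp` — **doubling identity** (characteristic `2`, any weight `f`, additive
  pointing `w`): `Σ_{S ⊆ B} (Σ_S w) · ê(S) · ê(B∖S) = (Σ_B w) · f(B)` with `ê = setExp f` (each partition with `m`
  blocks is counted `2^{m−1}` times).
* `zblock_reciprocity` — **Smith's (5b) identity in block form**: with `G(X) = (Σ_X t) q_t(A^X)` and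
  `H(X) = (Σ_X z) G(X)`: `(Σ_B z)(1 + Σ_B t) · q_t(A^B) = Σ_{S ⊆ B} H(S) · G(B∖S)` — for `Σ_B t = 0` this is
  `z_B · q_t(A^B) = Σ_S z_S t_S q_t(A^S) · t_{S′} q_t(A^{S′})`, i.e. `det N(A,z,t) = Σ_S det O(A,z,t)[S]·det O(A,t,t)[S′]`
  (`det O(A, x, u)[S] = u_S q_x(A^S)`, `det N(A, z, t) = z q_t(A) + t q_z(A)`).
Pure linear algebra over `𝔽₂`; consumed by `CongruentNumberGenusDeterminantRowFiveB`.
-/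

namespace Literature.NumberTheory.EllipticCurves.Smith2016

open _root_.Matrix Finset Literature.LinearAlgebra.Matrix Literature.Combinatorics.Enumerative

section CharTwoSetExp

variable {α : Type*} [LinearOrder α] {R : Type*} [CommSemiring R]

/-- The set exponential of the zero weight vanishes on nonempty sets. [cite: Stanley1999EC2, Cor. 5.1.6 (exponential formula; elementary finite form)] -/
theorem setExp_zero_of_nonempty {T : Finset α} (hT : T.Nonempty) : setExp (0 : Finset α → R) T = 0 := by
  rw [setExp_of_nonempty _ hT]
  exact sum_eq_zero fun B _ => by rw [Pi.zero_apply, zero_mul]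

/-- In characteristic `2`, `setExp (f + f) T = [T = ∅]`. [cite: Stanley1999EC2, Cor. 5.1.6 (exponential formula; elementary finite form)] -/
theorem setExp_add_self (h2 : (2 : R) = 0) (f : Finset α → R) (T : Finset α) :
    setExp (f + f) T = if T = ∅ then 1 else 0 := by
  have hff : f + f = 0 := by
    funext C
    rw [Pi.add_apply, Pi.zero_apply, ← two_mul, h2, zero_mul]
  rw [hff]
  by_cases hT : T = ∅
  · rw [if_pos hT, hT, setExp_empty]
  · rw [if_neg hT, setExp_zero_of_nonempty (nonempty_iff_ne_empty.mpr hT)]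

/-- **The doubling identity** (characteristic `2`): for any block weight `f` and additive pointing weight `w`,
`Σ_{S ⊆ B} (Σ_{i∈S} w_i) · setExp f S · setExp f (B∖S) = (Σ_{i∈B} w_i) · f(B)` — a partition of `B` into `m` blocks
split into two labelled groups in `2^m` ways contributes `2^{m−1} (Σ_B w) ∏ f`, which vanishes unless `m = 1`.
[cite: Stanley1999EC2, Cor. 5.1.6 (exponential formula; elementary finite form)] -/
theorem sum_powerset_pointed_setExp_mul_setExp (h2 : (2 : R) = 0) (w : α → R) (f : Finset α → R)
    (B : Finset α) :
    ∑ S ∈ B.powerset, (∑ i ∈ S, w i) * (setExp f S * setExp f (B \ S)) = (∑ i ∈ B, w i) * f B := by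
  -- point the block of `S` carrying the weight (pointing lemma, backwards), then swap to `C ⊆ B`
  have hpoint : ∀ S ∈ B.powerset, (∑ i ∈ S, w i) * (setExp f S * setExp f (B \ S)) =
      ∑ C ∈ S.powerset, (∑ i ∈ C, w i) * (f C * setExp f (S \ C)) * setExp f (B \ S) := by
    intro S _
    rw [← mul_assoc, ← setExp_point w f S, sum_mul]
  have key := sum_powerset_sum_powerset_sub B
    (fun C S => (∑ i ∈ C, w i) * (f C * setExp f (S \ C)) * setExp f (B \ S))
  rw [sum_congr rfl hpoint, key]
  -- for fixed `C`, the inner sum is `setExp (f + f) (B ∖ C) = [C = B]`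
  have hinner : ∀ C ∈ B.powerset,
      ∑ U ∈ (B \ C).powerset, (∑ i ∈ C, w i) * (f C * setExp f ((C ∪ U) \ C)) * setExp f (B \ (C ∪ U)) =
        (∑ i ∈ C, w i) * f C * (if B \ C = ∅ then 1 else 0) := by
    intro C hC
    rw [← setExp_add_self h2 f (B \ C), setExp_add, mul_sum]
    refine sum_congr rfl fun U hU => ?_
    rw [mem_powerset] at hU
    have hdisj : Disjoint C U := disjoint_of_subset_right hU disjoint_sdiff
    rw [union_sdiff_cancel_left hdisj, sdiff_sdiff_left, sup_eq_union]
    ring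
  rw [sum_congr rfl hinner, sum_eq_single_of_mem B (mem_powerset.mpr (Subset.refl B))
    (fun C hC hCB => by
      rw [mem_powerset] at hC
      have hne : B \ C ≠ ∅ := by
        intro h
        exact hCB (Subset.antisymm hC (sdiff_eq_empty_iff_subset.mp h))
      rw [if_neg hne, mul_zero]),
    sdiff_self, bot_eq_empty, if_pos rfl, mul_one]

end CharTwoSetExp

section Reciprocity

variable {V : Type*} [Fintype V] [LinearOrder V]

/-- With zero root weights the block weight `q_0` vanishes. [cite: ChebotarevAgaev2002, §3 Thm. 2] -/
theorem qwt_zero_weight (a : V → V → ZMod 2) : qwt a (0 : V → ZMod 2) = 0 := by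
  funext B
  unfold qwt
  exact sum_eq_zero fun t _ => by rw [Pi.zero_apply, zero_mul]

/-- The Laplacian-type matrix of a nonempty block is singular (zero row sums; the matrix-forest theorem with
no roots). [cite: ChebotarevAgaev2002, §3 Thm. 2] -/
theorem det_lap_zero_of_nonempty (a : V → V → ZMod 2) {S : Finset V} (hS : S.Nonempty) :
    (lap a S 0).det = 0 := by
  rw [det_lap_eq_setExp, qwt_zero_weight, setExp_zero_of_nonempty hS]

omit [Fintype V] in
/-- **Reciprocity transposes the Laplacian into a rank-one perturbation**: if `a i j + a j i = t_i t_j` for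
`i ≠ j` in `S`, then `(L_S + D_t)ᵀ = L_S + u uᵀ` with `u = t·1_S` (over `𝔽₂`, where `t_i² = t_i`).
[cite: Smith2016CongruentDensity, Prop. 2.4 ("A_ij + A_ji = y_i y_j for i and j not equal") and §2.2 case 5(b)] -/
theorem lap_transpose_eq_add_vecMulVec (a : V → V → ZMod 2) (t : V → ZMod 2) {S : Finset V}
    (hrec : ∀ i ∈ S, ∀ j ∈ S, i ≠ j → a i j + a j i = t i * t j) :
    (lap a S t)ᵀ = lap a S 0 + vecMulVec (fun i => if i ∈ S then t i else 0) (fun i => if i ∈ S then t i else 0) := by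
  have hsq : ∀ x : ZMod 2, x * x = x := by decide
  ext i j
  rw [transpose_apply, Matrix.add_apply, vecMulVec_apply, lap_apply, lap_apply]
  by_cases hj : j ∈ S
  · by_cases hi : i ∈ S
    · rw [if_pos (And.intro hj hi), if_pos (And.intro hi hj), if_pos hi, if_pos hj]
      by_cases hji : j = i
      · subst hji
        rw [if_pos rfl, if_pos rfl, Pi.zero_apply, zero_add, hsq, add_comm]
      · rw [if_neg hji, if_neg (Ne.symm hji)]
        have h := hrec i hi j hj (Ne.symm hji)
        have h2 : ∀ x y z : ZMod 2, x + y = z → y = x + z := by decide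
        exact h2 _ _ _ h
    · have hji : j ≠ i := fun h => hi (h ▸ hj)
      rw [if_neg (show ¬(j ∈ S ∧ i ∈ S) from fun h => hi h.2),
        if_neg (show ¬(i ∈ S ∧ j ∈ S) from fun h => hi h.1), if_neg hi, zero_mul, add_zero,
        if_neg hji, if_neg (Ne.symm hji)]
  · rw [if_neg (show ¬(j ∈ S ∧ i ∈ S) from fun h => hj h.1),
      if_neg (show ¬(i ∈ S ∧ j ∈ S) from fun h => hj h.2), if_neg hj, mul_zero, add_zero]
    by_cases hji : j = i
    · rw [if_pos hji, if_pos hji.symm]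
    · rw [if_neg hji, if_neg (Ne.symm hji)]

/-- **The reciprocity lemma**: for arc weights with `a i j + a j i = t_i t_j` (`i ≠ j ∈ S`) and `S ≠ ∅`,
`Σ_{π ∈ Part(S)} ∏_{C∈π} q_t(A^C) = (Σ_{i∈S} t_i) · q_t(A^S)` in `𝔽₂`
(`= det(A^S + D_t) = det((A^S)ᵀ … ) = det(A^S + t tᵀ) = det A^S + tᵀ adj(A^S) t`, and every entry of `adj(A^S) t` is
`det(A^S | t) = q_t(A^S)`).  In Smith's notation: `det O(A, t, t)[S] = t_S · q_t(A^S)` evaluates the rooted forest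
sum of `A^S` with roots `t`. [cite: Smith2016CongruentDensity, §2.2 (source cnc2.tex l. 36–40: det O(A, y, y)[S′] and Table 1 row d ≡ 3 (4); l. 52–62: case 5(b))] [cite: HornJohnson2013, §0.8.5 (Cauchy's rank-one determinant formula)] -/
theorem setExp_qwt_eq_sum_mul_qwt (a : V → V → ZMod 2) (t : V → ZMod 2) {S : Finset V} (hS : S.Nonempty)
    (hrec : ∀ i ∈ S, ∀ j ∈ S, i ≠ j → a i j + a j i = t i * t j) :
    setExp (qwt a t) S = (∑ i ∈ S, t i) * qwt a t S := by
  rw [← det_lap_eq_setExp, ← det_transpose, lap_transpose_eq_add_vecMulVec a t hrec, det_add_vecMulVec,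
    det_lap_zero_of_nonempty a hS, zero_add, dotProduct]
  have hc : ∀ c, (if c ∈ S then t c else 0) * ((lap a S 0).adjugate *ᵥ fun i => if i ∈ S then t i else 0) c =
      if c ∈ S then t c * qwt a t S else 0 := by
    intro c
    by_cases hcS : c ∈ S
    · rw [if_pos hcS, if_pos hcS, ← det_updateCol_eq_adjugate_mulVec, ← qwt_eq_det_updateCol a t hcS]
    · rw [if_neg hcS, if_neg hcS, zero_mul]
  rw [Fintype.sum_congr _ _ hc, ← sum_filter, filter_mem_eq_inter, univ_inter, sum_mul]

/-- **Smith's case-5(b) identity in block form** (reciprocity on `B`): with `G(X) = (Σ_X t) · q_t(A^X)` and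
`H(X) = (Σ_X z) · G(X)`,
`(Σ_B z) · (1 + Σ_B t) · q_t(A^B) = Σ_{S ⊆ B} H(S) · G(B ∖ S)`.
For `Σ_B t = 0` (the blocks `d ≡ 1 (4)`) this reads `z_B · q_t(A^B) = Σ_S (z_S t_S q_t(A^S)) · (t_{S′} q_t(A^{S′}))`,
which is the source's `det N(A, z, y) = Σ_S det O(A, z, y)[S] · det O(A, y, y)[S′]` with the `O`-blocks evaluated;
for `Σ_B t = 1` both sides vanish.  Proof: the doubling identity with pointing weight `z` and the reciprocity lemma
on every sub-block. [cite: Smith2016CongruentDensity, §2.2 case 5(b) (source cnc2.tex l. 52–62: "det N(A, z, y) = Σ_{S ⊆ [r]} det O(A, z, y)[S] det O(A, y, y)[S′]")] -/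
theorem zblock_reciprocity (a : V → V → ZMod 2) (t z : V → ZMod 2) {B : Finset V}
    (hrec : ∀ i ∈ B, ∀ j ∈ B, i ≠ j → a i j + a j i = t i * t j) :
    (∑ i ∈ B, z i) * (1 + ∑ i ∈ B, t i) * qwt a t B =
      ∑ S ∈ B.powerset, ((∑ i ∈ S, z i) * ((∑ i ∈ S, t i) * qwt a t S)) *
        ((∑ i ∈ B \ S, t i) * qwt a t (B \ S)) := by
  rcases B.eq_empty_or_nonempty with rfl | hB
  · simp [qwt]
  have h2 : (2 : ZMod 2) = 0 := by decide
  have hdouble := sum_powerset_pointed_setExp_mul_setExp h2 z (qwt a t) B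
  -- split off the term `S = B` on the left of the doubling identity
  rw [← add_sum_erase _ _ (mem_powerset.mpr (Subset.refl B)), sdiff_self, bot_eq_empty, setExp_empty, mul_one,
    setExp_qwt_eq_sum_mul_qwt a t hB hrec] at hdouble
  -- the remaining terms: `S ⊊ B`, both `S` (if nonempty) and `B ∖ S` carry the reciprocity lemma
  have hterm : ∀ S ∈ B.powerset.erase B, (∑ i ∈ S, z i) * (setExp (qwt a t) S * setExp (qwt a t) (B \ S)) =
      ((∑ i ∈ S, z i) * ((∑ i ∈ S, t i) * qwt a t S)) * ((∑ i ∈ B \ S, t i) * qwt a t (B \ S)) := by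
    intro S hS
    rw [mem_erase, mem_powerset] at hS
    have hBS : (B \ S).Nonempty := by
      rw [nonempty_iff_ne_empty, Ne, sdiff_eq_empty_iff_subset]
      exact fun h => hS.1 (Subset.antisymm hS.2 h)
    have hrecS : ∀ i ∈ S, ∀ j ∈ S, i ≠ j → a i j + a j i = t i * t j :=
      fun i hi j hj hij => hrec i (hS.2 hi) j (hS.2 hj) hij
    have hrecBS : ∀ i ∈ B \ S, ∀ j ∈ B \ S, i ≠ j → a i j + a j i = t i * t j :=
      fun i hi j hj hij => hrec i (sdiff_subset hi) j (sdiff_subset hj) hij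
    rw [setExp_qwt_eq_sum_mul_qwt a t hBS hrecBS]
    rcases S.eq_empty_or_nonempty with rfl | hSne
    · rw [sum_empty, zero_mul, zero_mul, zero_mul]
    · rw [setExp_qwt_eq_sum_mul_qwt a t hSne hrecS]
      ring
  rw [sum_congr rfl hterm] at hdouble
  -- the full right-hand side also has a (vanishing) `S = B` term
  rw [← add_sum_erase _ _ (mem_powerset.mpr (Subset.refl B)), sdiff_self, bot_eq_empty, sum_empty, zero_mul,
    mul_zero, zero_add, ← sub_eq_iff_eq_add'.mpr hdouble.symm, sub_eq_add_neg, ZMod.neg_eq_self_mod_two]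
  ring

end Reciprocity

end Literature.NumberTheory.EllipticCurves.Smith2016
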